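import Literature.MathematicalPhysics.QuantumManyBody.GroundStateFeynmanKacWitness
import Literature.MathematicalPhysics.QuantumManyBody.GroundStateFeynmanKacDisplacement
import Literature.Probability.Process.BrownianRunningMaxBounds
import HarnessLib

/-!
# Ground state of the Feynman–Kac semigroup, XIV: continuity up to the boundary

Part of the proof of `GroundStateFeynmanKac` (Chung–Zhao (1995), Thm 3.17 (iv): eigenfunctions
of the killed semigroup on a regular domain are in `C₀(D)`).  For the continuous representative
`φ₀ = μ₀⁻¹ T_1 e⁺` of `GroundStateFeynmanKacWitness.lean` we prove **global continuity**
(`continuous_gs`): on the open box it is the strong Feller property (`continuousAt_gs`), off the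
closed box `φ₀ = 0`, and at the boundary `φ₀(X) → 0`, because

  `|T_1 f (X)|² ≤ P_X(τ_Λ > 1) · (4π)^{-3N/2} ∫_Λ f²`   (`sq_fkReal_le_measure_survives_mul`,
  Cauchy–Schwarz in the killed path measure keeping its total mass), and the survival
  probability is controlled by ONE coordinate: `P_X(τ_Λ > 1) ≤ P(∀ r ≤ 1, b_r < (L − X_{ik})/√2)`
  and `≤ P(∀ r ≤ 1, −b_r < X_{ik}/√2)`, both `≤ 2 (m/√2)^{1/2}` by the small-ball bound for the
  one-sided running maximum (`measure_forall_lt_le_of_isPreBrownianReal`, for `b` and for `−b`,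
  `IsPreBrownianReal.neg`) — the regularity of every boundary point of a box.

## References

* K. L. Chung, Z. Zhao, *From Brownian Motion to Schrödinger's Equation* (1995), Thm 3.17 (iv),
  §1.4 (regular points). [cite: ChungZhao1995, Thm 3.17]
* R. Durrett, *Probability: Theory and Examples* (2019), Thm 7.5.5. [folklore]
-/

noncomputable section

namespace Literature.MathematicalPhysics.QuantumManyBody.BoseGas

open MeasureTheory ProbabilityTheory Filter Set
open scoped ENNReal NNReal Topology InnerProductSpace
open Literature.Probability.Process

variable {N : ℕ}

/-! ### Cauchy–Schwarz keeping the mass of the killed path measure -/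

/-- **`(E_X[w F(B_t)])² ≤ E_X[w] · E_X[w F(B_t)²]`** (Cauchy–Schwarz in `fkPathMeasure`).
[folklore] -/
theorem lintegral_fkWeight_mul_sq_le_mass_mul {v : ℝ → ℝ≥0∞} (hv : Measurable v) (L t : ℝ)
    {F : Config N → ℝ≥0∞} (hF : Measurable F) (X : Config N) :
    (∫⁻ ω, fkWeight v L t X ω * F (worldLine X ω t.toNNReal) ∂wienerPaths N) ^ (2 : ℝ) ≤
      (∫⁻ ω, fkWeight v L t X ω ∂wienerPaths N) *
        ∫⁻ ω, fkWeight v L t X ω * F (worldLine X ω t.toNNReal) ^ (2 : ℝ) ∂wienerPaths N := by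
  have hFm : AEMeasurable (fun ω => F (worldLine X ω t.toNNReal)) (fkPathMeasure v L t X) :=
    (hF.comp (measurable_worldLine X _)).aemeasurable
  have h1 := ENNReal.lintegral_mul_le_Lp_mul_Lq (fkPathMeasure v L t X)
    Real.HolderConjugate.two_two (f := fun _ => 1)
    (g := fun ω => F (worldLine X ω t.toNNReal)) aemeasurable_const hFm
  simp only [ENNReal.one_rpow] at h1
  have h2 := ENNReal.rpow_le_rpow h1 (z := 2) (by norm_num)
  rw [ENNReal.mul_rpow_of_nonneg _ _ (by norm_num), ← ENNReal.rpow_mul, ← ENNReal.rpow_mul,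
    show (1 / 2 : ℝ) * 2 = 1 by norm_num, ENNReal.rpow_one, ENNReal.rpow_one,
    lintegral_fkPathMeasure hv, lintegral_fkPathMeasure hv, lintegral_fkPathMeasure hv] at h2
  simpa using h2

/-- **`|T_t f(X)|² ≤ E_X[w_t] · (4πt)^{-3N/2} ∫_Λ f²`**: the pointwise `L² → L^∞` bound keeping
the survival mass. [cite: ChungZhao1995, Thm 3.17] -/
theorem enorm_fkReal_sq_le_mass_mul {v : ℝ → ℝ≥0∞} (hv : Measurable v) (L : ℝ) {t : ℝ}
    (ht : 0 < t) {f : Config N → ℝ} (hf : Measurable f) (X : Config N) :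
    ‖fkReal v L t f X‖ₑ ^ (2 : ℝ) ≤
      (∫⁻ ω, fkWeight v L t X ω ∂wienerPaths N) *
        ((∏ _i : Fin N, ∏ _k : Fin 3, ENNReal.ofReal (Real.sqrt (2 * Real.pi * (2 * t.toNNReal)))⁻¹) *
          ∫⁻ Y in boxN N L, ‖f Y‖ₑ ^ (2 : ℝ)) := by
  set G : Config N → ℝ≥0∞ := fun Y => ‖(boxN N L).indicator f Y‖ₑ with hG
  have hGm : Measurable G := (hf.indicator (measurableSet_boxN N L)).enorm
  have ht0 : t.toNNReal ≠ 0 := by simpa using ht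
  have h1 : ‖fkReal v L t f X‖ₑ ≤ ∫⁻ ω, fkWeight v L t X ω * G (worldLine X ω t.toNNReal)
      ∂wienerPaths N := by
    rw [← fkReal_indicator v L ht.le f]
    exact enorm_fkReal_le v L t _ X
  calc ‖fkReal v L t f X‖ₑ ^ (2 : ℝ)
      ≤ (∫⁻ ω, fkWeight v L t X ω * G (worldLine X ω t.toNNReal) ∂wienerPaths N) ^ (2 : ℝ) :=
        ENNReal.rpow_le_rpow h1 (by norm_num)
    _ ≤ (∫⁻ ω, fkWeight v L t X ω ∂wienerPaths N) *
          ∫⁻ ω, fkWeight v L t X ω * G (worldLine X ω t.toNNReal) ^ (2 : ℝ) ∂wienerPaths N :=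
        lintegral_fkWeight_mul_sq_le_mass_mul hv L t hGm X
    _ ≤ (∫⁻ ω, fkWeight v L t X ω ∂wienerPaths N) *
          ∫⁻ ω, G (worldLine X ω t.toNNReal) ^ (2 : ℝ) ∂wienerPaths N := by
        gcongr with ω
        calc fkWeight v L t X ω * G (worldLine X ω t.toNNReal) ^ (2 : ℝ)
            ≤ 1 * G (worldLine X ω t.toNNReal) ^ (2 : ℝ) := by
              gcongr; exact fkWeight_le_one v L t X ω
          _ = _ := one_mul _
    _ ≤ _ := by
        gcongr
        rw [lintegral_worldLine_eq X ht0 (hGm.pow_const _)]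
        calc ∫⁻ Y, (∏ i, ∏ k, gaussianPDF (X i k) (2 * t.toNNReal) (Y i k)) * G Y ^ (2 : ℝ)
            ≤ ∫⁻ Y, (∏ _i : Fin N, ∏ _k : Fin 3,
                ENNReal.ofReal (Real.sqrt (2 * Real.pi * (2 * t.toNNReal)))⁻¹) * G Y ^ (2 : ℝ) :=
              lintegral_mono fun Y => mul_le_mul' (heatKernel_le X Y _) le_rfl
          _ = _ := by
              rw [lintegral_const_mul _ (hGm.pow_const _), hG, lintegral_enorm_indicator_sq L f]

/-- `E_X[w_t] ≤ P_X(τ_Λ > t)`. [folklore] -/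
theorem lintegral_fkWeight_le_measure_survives (v : ℝ → ℝ≥0∞) (L t : ℝ) (X : Config N) :
    ∫⁻ ω, fkWeight v L t X ω ∂wienerPaths N ≤ wienerPaths N (survives L t X) := by
  rw [← lintegral_indicator_one (measurableSet_survives L t X)]
  refine lintegral_mono fun ω => ?_
  by_cases hω : ω ∈ survives L t X
  · rw [indicator_of_mem hω, Pi.one_apply]; exact fkWeight_le_one v L t X ω
  · simp [fkWeight, indicator_of_notMem hω]

/-! ### Survival is controlled by one coordinate -/

/-- Coordinates of the world-lines: `(B_s)_{ik} = X_{ik} + √2 b_s(ω i k)`. [folklore] -/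
theorem worldLine_apply_apply (X : Config N) (ω : PathSpace N) (s : ℝ≥0) (i : Fin N) (k : Fin 3) :
    worldLine X ω s i k = X i k + Real.sqrt 2 * brownian s (ω i k) := by
  simp [worldLine]

/-- **Upper face**: `P_X(τ_Λ > t) ≤ P(∀ r ≤ t, b_r < (L − X_{ik})/√2)`. [folklore] -/
theorem measure_survives_le_upper {L t : ℝ} (ht : 0 ≤ t) (X : Config N) (i : Fin N) (k : Fin 3) :
    wienerPaths N (survives L t X) ≤
      preWienerMeasure {η | ∀ r ≤ t.toNNReal, brownian r η < (L - X i k) / Real.sqrt 2} := by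
  have hsub : survives L t X ⊆ (fun ω : PathSpace N => ω i k) ⁻¹'
      {η | ∀ r ≤ t.toNNReal, brownian r η < (L - X i k) / Real.sqrt 2} := by
    intro ω hω r hr
    have hr' : (r : ℝ) ∈ Icc 0 t := ⟨r.coe_nonneg, by
      have := (Real.le_toNNReal_iff_coe_le ht).1 hr; exact this⟩
    have hmem := hω r hr'
    rw [Real.toNNReal_coe] at hmem
    have hlt : worldLine X ω r i k < L := (hmem i k).2
    rw [worldLine_apply_apply] at hlt
    rw [lt_div_iff₀ (Real.sqrt_pos.2 (by norm_num : (0 : ℝ) < 2))]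
    linarith [mul_comm (Real.sqrt 2) (brownian r (ω i k))]
  calc wienerPaths N (survives L t X)
      ≤ wienerPaths N ((fun ω : PathSpace N => ω i k) ⁻¹'
          {η | ∀ r ≤ t.toNNReal, brownian r η < (L - X i k) / Real.sqrt 2}) := measure_mono hsub
    _ ≤ (wienerPaths N).map (fun ω : PathSpace N => ω i k)
          {η | ∀ r ≤ t.toNNReal, brownian r η < (L - X i k) / Real.sqrt 2} :=
        Measure.le_map_apply (measurePreserving_apply₂ i k).measurable.aemeasurable _
    _ = _ := by rw [(measurePreserving_apply₂ i k).map_eq]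

/-- **Lower face**: `P_X(τ_Λ > t) ≤ P(∀ r ≤ t, −b_r < X_{ik}/√2)`. [folklore] -/
theorem measure_survives_le_lower {L t : ℝ} (ht : 0 ≤ t) (X : Config N) (i : Fin N) (k : Fin 3) :
    wienerPaths N (survives L t X) ≤
      preWienerMeasure {η | ∀ r ≤ t.toNNReal, (-brownian) r η < X i k / Real.sqrt 2} := by
  have hsub : survives L t X ⊆ (fun ω : PathSpace N => ω i k) ⁻¹'
      {η | ∀ r ≤ t.toNNReal, (-brownian) r η < X i k / Real.sqrt 2} := by
    intro ω hω r hr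
    have hr' : (r : ℝ) ∈ Icc 0 t := ⟨r.coe_nonneg, by
      have := (Real.le_toNNReal_iff_coe_le ht).1 hr; exact this⟩
    have hmem := hω r hr'
    rw [Real.toNNReal_coe] at hmem
    have hlt : 0 < worldLine X ω r i k := (hmem i k).1
    rw [worldLine_apply_apply] at hlt
    show -brownian r (ω i k) < X i k / Real.sqrt 2
    rw [lt_div_iff₀ (Real.sqrt_pos.2 (by norm_num : (0 : ℝ) < 2))]
    linarith [mul_comm (Real.sqrt 2) (brownian r (ω i k))]
  calc wienerPaths N (survives L t X)
      ≤ wienerPaths N ((fun ω : PathSpace N => ω i k) ⁻¹'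
          {η | ∀ r ≤ t.toNNReal, (-brownian) r η < X i k / Real.sqrt 2}) := measure_mono hsub
    _ ≤ (wienerPaths N).map (fun ω : PathSpace N => ω i k)
          {η | ∀ r ≤ t.toNNReal, (-brownian) r η < X i k / Real.sqrt 2} :=
        Measure.le_map_apply (measurePreserving_apply₂ i k).measurable.aemeasurable _
    _ = _ := by rw [(measurePreserving_apply₂ i k).map_eq]

/-- **Small-ball control of survival near the upper face**: for `0 < L − X_{ik} ≤ √2`,
`P_X(τ_Λ > 1) ≤ 2 ((L − X_{ik})/√2)^{1/2}`. [cite: ChungZhao1995, Thm 3.17] -/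
theorem measure_survives_one_le_upper {L : ℝ} (X : Config N) (i : Fin N) (k : Fin 3)
    (h0 : 0 < L - X i k) (h1 : L - X i k ≤ Real.sqrt 2) :
    wienerPaths N (survives L 1 X) ≤
      ENNReal.ofReal (2 * Real.sqrt ((L - X i k) / Real.sqrt 2)) := by
  have hs2 : 0 < Real.sqrt 2 := Real.sqrt_pos.2 (by norm_num)
  have hm : 0 < (L - X i k) / Real.sqrt 2 := div_pos h0 hs2
  have hm1 : (L - X i k) / Real.sqrt 2 ≤ Real.sqrt (1 : ℝ≥0) := by
    rw [NNReal.coe_one, Real.sqrt_one, div_le_one hs2]; exact h1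
  have h := measure_forall_lt_le_of_isPreBrownianReal
    Literature.Probability.RandomPlanarGeometry.isPreBrownianReal_brownian measurable_brownian
    continuous_brownian one_pos hm hm1
  simp only [NNReal.coe_one, Real.sqrt_one, div_one] at h
  refine (measure_survives_le_upper zero_le_one X i k).trans ?_
  simpa using h

/-- **Small-ball control of survival near the lower face**: for `0 < X_{ik} ≤ √2`,
`P_X(τ_Λ > 1) ≤ 2 (X_{ik}/√2)^{1/2}` (the reflected motion `−b`). [cite: ChungZhao1995, Thm 3.17] -/
theorem measure_survives_one_le_lower {L : ℝ} (X : Config N) (i : Fin N) (k : Fin 3)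
    (h0 : 0 < X i k) (h1 : X i k ≤ Real.sqrt 2) :
    wienerPaths N (survives L 1 X) ≤ ENNReal.ofReal (2 * Real.sqrt (X i k / Real.sqrt 2)) := by
  have hs2 : 0 < Real.sqrt 2 := Real.sqrt_pos.2 (by norm_num)
  have hm : 0 < X i k / Real.sqrt 2 := div_pos h0 hs2
  have hm1 : X i k / Real.sqrt 2 ≤ Real.sqrt (1 : ℝ≥0) := by
    rw [NNReal.coe_one, Real.sqrt_one, div_le_one hs2]; exact h1
  have h := measure_forall_lt_le_of_isPreBrownianReal
    Literature.Probability.RandomPlanarGeometry.isPreBrownianReal_brownian.neg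
    (fun t => (measurable_brownian t).neg) (fun ω => (continuous_brownian ω).neg) one_pos hm hm1
  simp only [NNReal.coe_one, Real.sqrt_one, div_one] at h
  refine (measure_survives_le_lower zero_le_one X i k).trans ?_
  simpa using h

/-! ### Global continuity of the ground-state function -/

section Continuity

variable {v : ℝ → ℝ≥0∞} {C : ℝ≥0} {L : ℝ} {e : Lp ℝ 2 (volume.restrict (boxN N L))}
  {φ : Config N → ℝ}

/-- **Boundary decay**: `φ₀(X)² ≤ K · P_X(τ_Λ > 1)` on the box, with a finite constant `K`.
[cite: ChungZhao1995, Thm 3.17] -/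
theorem gs_sq_le_measure_survives (hv : Measurable v) {μ₀ : ℝ} (hμ₀ : 0 < μ₀)
    (hφ : φ = fun X => μ₀⁻¹ * fkReal v L 1 (fun Y => max ((e : Config N → ℝ) Y) 0) X) :
    ∃ K : ℝ, 0 ≤ K ∧ ∀ X, φ X ^ 2 ≤ K * (wienerPaths N (survives L 1 X)).toReal := by
  set Kₑ : ℝ≥0∞ := (∏ _i : Fin N, ∏ _k : Fin 3,
      ENNReal.ofReal (Real.sqrt (2 * Real.pi * (2 * (1 : ℝ).toNNReal)))⁻¹) *
    ∫⁻ Y in boxN N L, ‖max ((e : Config N → ℝ) Y) 0‖ₑ ^ (2 : ℝ) with hKₑ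
  have hKₑ_top : Kₑ ≠ ⊤ := by
    refine ENNReal.mul_ne_top ?_ (setLIntegral_posRep_sq_ne_top e)
    exact (ENNReal.prod_lt_top fun i _ => ENNReal.prod_lt_top fun k _ => ENNReal.ofReal_lt_top).ne
  refine ⟨μ₀⁻¹ ^ 2 * Kₑ.toReal, by positivity, fun X => ?_⟩
  have hb := enorm_fkReal_sq_le_mass_mul hv L one_pos (measurable_posRep e) X
  have hb' : ‖fkReal v L 1 (fun Y => max ((e : Config N → ℝ) Y) 0) X‖ₑ ^ (2 : ℝ) ≤
      wienerPaths N (survives L 1 X) * Kₑ :=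
    hb.trans (mul_le_mul' (lintegral_fkWeight_le_measure_survives v L 1 X) le_rfl)
  have hreal : fkReal v L 1 (fun Y => max ((e : Config N → ℝ) Y) 0) X ^ 2 ≤
      (wienerPaths N (survives L 1 X)).toReal * Kₑ.toReal := by
    have hfin : wienerPaths N (survives L 1 X) * Kₑ ≠ ⊤ :=
      ENNReal.mul_ne_top (measure_ne_top _ _) hKₑ_top
    have := ENNReal.toReal_mono hfin hb'
    rw [ENNReal.toReal_mul, ← ENNReal.toReal_rpow, Real.enorm_eq_ofReal_abs, ENNReal.toReal_ofReal
      (abs_nonneg _), Real.rpow_two, sq_abs] at this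
    exact this
  rw [hφ]
  simp only
  rw [mul_pow]
  calc (μ₀⁻¹) ^ 2 * fkReal v L 1 (fun Y => max ((e : Config N → ℝ) Y) 0) X ^ 2
      ≤ (μ₀⁻¹) ^ 2 * ((wienerPaths N (survives L 1 X)).toReal * Kₑ.toReal) := by gcongr
    _ = μ₀⁻¹ ^ 2 * Kₑ.toReal * (wienerPaths N (survives L 1 X)).toReal := by ring

/-- Coordinates are `1`-Lipschitz for the norm of `(ℝ³)^N`. [folklore] -/
theorem abs_apply_apply_sub_le (X Y : Config N) (i : Fin N) (k : Fin 3) :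
    |X i k - Y i k| ≤ ‖X - Y‖ := by
  calc |X i k - Y i k| = |(X - Y) i k| := by simp
    _ = ‖(X - Y) i k‖ := (Real.norm_eq_abs _).symm
    _ ≤ ‖(X - Y) i‖ := PiLp.norm_apply_le ((X - Y) i) k
    _ ≤ ‖X - Y‖ := norm_le_pi_norm (X - Y) i

/-- **The ground-state function is continuous on all of `(ℝ³)^N`** (strong Feller inside,
`0` outside, and boundary decay through the regularity of the boundary of the box).
[cite: ChungZhao1995, Thm 3.17] -/
theorem continuous_gs (hv : Measurable v) (hC : ∀ r, v r ≤ C) {μ₀ : ℝ} (hμ₀ : 0 < μ₀)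
    (hφ : φ = fun X => μ₀⁻¹ * fkReal v L 1 (fun Y => max ((e : Config N → ℝ) Y) 0) X) :
    Continuous φ := by
  obtain ⟨K, hK0, hK⟩ := gs_sq_le_measure_survives hv hμ₀ hφ
  rw [continuous_iff_continuousAt]
  intro X₀
  by_cases hX₀ : X₀ ∈ boxN N L
  · exact continuousAt_gs hv hC hφ hX₀
  -- at a point off the open box: `φ X₀ = 0` and `φ X → 0`
  have hφ0 : φ X₀ = 0 := gs_of_notMem hφ hX₀
  -- a bad coordinate
  obtain ⟨i, k, hik⟩ : ∃ i k, X₀ i k ≤ 0 ∨ L ≤ X₀ i k := by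
    by_contra hcon
    push Not at hcon
    exact hX₀ fun i k => ⟨(hcon i k).1, (hcon i k).2⟩
  rw [ContinuousAt, hφ0, Metric.tendsto_nhds]
  intro ε hε
  have hs2 : 0 < Real.sqrt 2 := Real.sqrt_pos.2 (by norm_num)
  -- `g d = K · 2 √(d/√2)` is continuous at `0` with value `0 < ε²`
  have hcont : Continuous fun d : ℝ => K * (2 * Real.sqrt (d / Real.sqrt 2)) := by fun_prop
  have h0 : (fun d : ℝ => K * (2 * Real.sqrt (d / Real.sqrt 2))) 0 < ε ^ 2 := by
    simp [pow_pos hε 2]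
  obtain ⟨δ₁, hδ₁, hδ₁ε⟩ := Metric.eventually_nhds_iff.1 ((hcont.tendsto 0).eventually
    (gt_mem_nhds h0))
  rw [Metric.eventually_nhds_iff]
  refine ⟨min (δ₁ / 2) (Real.sqrt 2), lt_min (half_pos hδ₁) hs2, fun X hX => ?_⟩
  rw [Real.dist_eq, sub_zero]
  have hXδ : ‖X - X₀‖ < min (δ₁ / 2) (Real.sqrt 2) := by rwa [← dist_eq_norm]
  have hX1 : ‖X - X₀‖ < δ₁ := (hXδ.trans_le (min_le_left _ _)).trans (half_lt_self hδ₁)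
  have hX2 : ‖X - X₀‖ < Real.sqrt 2 := hXδ.trans_le (min_le_right _ _)
  by_cases hX : X ∈ boxN N L
  swap
  · rw [gs_of_notMem hφ hX, abs_zero]; exact hε
  have hcoord := abs_apply_apply_sub_le X X₀ i k
  have hin : 0 < X i k ∧ X i k < L := hX i k
  -- the small parameter `m` and the survival bound
  obtain ⟨m, hm0, hmδ, hsurv⟩ : ∃ m : ℝ, 0 < m ∧ m ≤ ‖X - X₀‖ ∧
      wienerPaths N (survives L 1 X) ≤ ENNReal.ofReal (2 * Real.sqrt (m / Real.sqrt 2)) := by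
    rcases hik with h | h
    · have hm : X i k ≤ ‖X - X₀‖ := by
        have := (abs_le.1 (hcoord.trans le_rfl)).2
        linarith
      exact ⟨X i k, hin.1, hm, measure_survives_one_le_lower X i k hin.1 (hm.trans hX2.le)⟩
    · have hm : L - X i k ≤ ‖X - X₀‖ := by
        have := (abs_le.1 (hcoord.trans le_rfl)).1
        linarith
      exact ⟨L - X i k, by linarith [hin.2], hm,
        measure_survives_one_le_upper X i k (by linarith [hin.2]) (hm.trans hX2.le)⟩
  have hm1 : dist m 0 < δ₁ := by
    rw [Real.dist_eq, sub_zero, abs_of_pos hm0]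
    exact hmδ.trans_lt hX1
  have hgm : K * (2 * Real.sqrt (m / Real.sqrt 2)) < ε ^ 2 := hδ₁ε hm1
  have hsq : φ X ^ 2 < ε ^ 2 := by
    calc φ X ^ 2 ≤ K * (wienerPaths N (survives L 1 X)).toReal := hK X
      _ ≤ K * (2 * Real.sqrt (m / Real.sqrt 2)) := by
          gcongr
          exact ENNReal.toReal_le_of_le_ofReal (by positivity) hsurv
      _ < ε ^ 2 := hgm
  exact abs_lt_of_sq_lt_sq hsq hε.le

end Continuity

end Literature.MathematicalPhysics.QuantumManyBody.BoseGas
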